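import Literature.NumberTheory.EllipticCurves.PAdicLFunctionTame
import Literature.NumberTheory.EllipticCurves.PAdicLFunctionMinus
import HarnessLib

/-!
# The MINUS Mazur–Swinnerton-Dyer / Mazur–Tate–Teitelbaum measure at a TAME LEVEL `m` and the
# `χ`-twisted `p`-adic `L`-function `L⁻_p(f, α, χ, T)` built on the minus symbol (Dirichlet character `χ` mod `m`,
# `(m, p) = 1`) — DEFINITIONS ONLY (every `def` has a body; nothing asserted, no named fact)

The minus twin of `Literature.NumberTheory.EllipticCurves.PAdicLFunctionTame` (`msdMeasureTame`,
`padicLFunctionTame`: the PLUS measure at tame level `m`, Mazur–Tate–Teitelbaum §I.10 (10.1), §I.13; Matsuno 2000 §2),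
written symbol for symbol with the rational MINUS symbol `[r]⁻_f = ratMinusSymbol f r` of
`Literature.NumberTheory.EllipticCurves.PAdicLFunctionMinus` (which already carries the level-`1` minus measure
`msdMinusMeasure` and the odd branches `padicLFunctionMinusBranch`). Mazur–Tate–Teitelbaum construct ONE measure from the
modular symbol `{∞, ·}` on `ℤ_{p,M}^×` (§I.10: "Fix an integer `M > 0` prime to `p`", display (10.1)) and read its `±`
parts against `Ω^±_f` (§I.8: the symbols `[a/m]^±`); the `χ`-twisted function `L_p(f, α, χ, T)` for an ODD tame character
`χ` (§I.13–I.14) lives on the minus part. This file TYPES that minus part at tame level `m`: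

* `msdMeasureTameMinus f m α n a b = μ⁻_{f,α,m}((a + pⁿℤ_p) × {b}) = α⁻ⁿ [c/(pⁿm)]⁻_f − α⁻⁽ⁿ⁺¹⁾ [c/(pⁿ⁻¹m)]⁻_f`
  (`c = tameRep p m n a b` the Chinese-remainder representative of `(a mod pⁿ, b mod m)`, `tameFraction` its fraction —
  both from the plus file; MTT (10.1) with the minus symbol, uniformly in `n`).
* `padicLRiemannSumTameMinus f m α χ k n`, `padicLCoeffTameMinus f m α χ k`, **`padicLFunctionTameMinus f m α χ`** — the
  Riemann sums `∑_ζ ∑_{s mod pⁿ} ∑_{b mod m} χ(b) μ⁻_{f,α,m}((ζ γˢ + p^{n+e₀}ℤ_p) × {b}) · (s choose k)`, their limits, and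
  `L⁻_p(f, α, χ, T) = ∫_{ℤ_pˣ × ℤ/m} χ(x_m) (1+T)^{ℓ(x_p)} dμ⁻_{f,α,m}` for a Dirichlet character `χ` mod `m` WITH VALUES IN
  `ℚ_p` — literally the formulas of `padicLRiemannSumTame` / `padicLCoeffTame` / `padicLFunctionTame` with `μ⁻` for `μ⁺`.
  For `χ = ψ` quadratic ODD of conductor `m` this is the function whose Birch transform is `L_p(f ⊗ ψ, ψ(p) α, T)`
  (the PLUS function of the odd twist: `[x]⁺_{f_ψ} = c · Σ_b ψ(b) [x + b/m]⁻_f`, tree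
  `exists_rat_forall_ratPlusSymbol_charTwist_eq_of_odd`).

ANCHOR at `m = 1` (kernel lemmas of this file): `msdMeasureTameMinus f 1 α n a b = msdMinusMeasure f α n a`,
`padicLRiemannSumTameMinus f 1 α 1 k n = padicLMinusBranchRiemannSum f α 0 k n` (the `ω⁰`-branch Riemann sum of the minus
measure) — the SAME normalisation as the level-`1` minus objects. No named fact is introduced (D-0026); the distribution
relation, boundedness and Birch's lemma for these objects are THEOREMS of the companion `…TameMinusProofs` /
`…TameMinusBirch{Measure,Transform}Proofs` files.

Motivation: crux stmt-BirchSwinnertonDyer-20368 (cell `bsd-print-cf2`, road (C) `disegni-pair-two`, memo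
`Cruxes/SplitBadTwoRankOneOfFacts/PERIOD-CANCELS-w8g24.md` §3, typing gap T⁻): for a NEGATIVE twist parameter `d′`
(`χ_{d′}` odd) the `2`-adic `L`-function of `cm7^{(d′)}` is Birch-transported to the minus tame function of the level-`49`
form, which makes the period-ratio class constant cancel exactly as in the `d′ > 0` half.

References: B. Mazur, J. Tate, J. Teitelbaum, Invent. Math. 84 (1986), §I.8, §I.10 (10.1), §I.13 [MazurTateTeitelbaum1986Invent];
K. Matsuno, J. Number Theory 84 (2000), §2 (p. 83) [Matsuno2000]; B. Mazur, P. Swinnerton-Dyer, Invent. Math. 25 (1974) §8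
[MazurSwinnertonDyer1974Invent].
-/

noncomputable section

open scoped MatrixGroups ModularForm

open CongruenceSubgroup Filter Topology Literature.NumberTheory.EllipticCurves.ModularForms

namespace Literature.NumberTheory.EllipticCurves

/-! ### The minus measure at tame level `m` -/

section Measure

variable {N : ℕ} (f : CuspForm (Gamma0 N) 2) {p : ℕ} [Fact p.Prime] (m : ℕ)

/-- The **minus Mazur–Swinnerton-Dyer / Mazur–Tate–Teitelbaum measure at tame level `m`**,
`μ⁻_{f,α,m}((a + pⁿℤ_p) × {b}) = α⁻ⁿ [c/(pⁿm)]⁻_f − α⁻⁽ⁿ⁺¹⁾ [c/(pⁿ⁻¹m)]⁻_f` for `a : ZMod (p ^ n)`, `b : ZMod m`,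
`c = tameRep p m n a b` the Chinese-remainder representative, `c/(pⁿ⁻¹m) = p · c/(pⁿm)` (Mazur–Tate–Teitelbaum §I.10
(10.1) with trivial Nebentypus, read on the MINUS symbol `[·]⁻_f = ratMinusSymbol f`, cast `ℚ → ℚ_p`); the minus twin of
`msdMeasureTame`, written uniformly in `n`, and at `m = 1` equal to `msdMinusMeasure f α` (`msdMeasureTameMinus_one`). Junk
(harmless) for `α = 0` or `(m, p) ≠ 1`. [cite: MazurTateTeitelbaum1986Invent, §I.10 (10.1) (pp. 12–13)]
[cite: Matsuno2000, §2 (p. 83, the measure μ_{E,m})] -/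
def msdMeasureTameMinus (α : ℚ_[p]) (n : ℕ) (a : ZMod (p ^ n)) (b : ZMod m) : ℚ_[p] :=
  α⁻¹ ^ n * (ratMinusSymbol f (tameFraction p m n a b) : ℚ_[p]) -
    α⁻¹ ^ (n + 1) * (ratMinusSymbol f ((p : ℚ) * tameFraction p m n a b) : ℚ_[p])

/-- **Anchor**: at tame level `m = 1` the minus tame measure IS the level-`1` minus measure of `PAdicLFunctionMinus`,
`msdMeasureTameMinus f 1 α n a b = msdMinusMeasure f α n a` (both cases of `msdMinusMeasure`'s definition).
[cite: MazurTateTeitelbaum1986Invent, §I.10 (10.1) (pp. 12–13)] -/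
theorem msdMeasureTameMinus_one (α : ℚ_[p]) (n : ℕ) (a : ZMod (p ^ n)) (b : ZMod 1) :
    msdMeasureTameMinus f 1 α n a b = msdMinusMeasure f α n a := by
  have hp0 : (p : ℚ) ≠ 0 := by exact_mod_cast (Fact.out : p.Prime).ne_zero
  rw [msdMeasureTameMinus, tameFraction_one]
  cases n with
  | zero =>
    have ha : a.val = 0 := by
      haveI : Subsingleton (ZMod (p ^ 0)) := (ZMod.subsingleton_iff).mpr (pow_zero p)
      rw [Subsingleton.elim a 0, ZMod.val_zero]
    simp only [msdMinusMeasure, ha, Nat.cast_zero, zero_div, mul_zero, pow_zero, one_mul]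
    ring
  | succ n =>
    have h : (p : ℚ) * ((a.val : ℚ) / (p : ℚ) ^ (n + 1)) = (a.val : ℚ) / (p : ℚ) ^ n := by
      field_simp
      ring
    simp only [msdMinusMeasure, h]

end Measure

/-! ### The `χ`-twisted `p`-adic `L`-function of the minus measure at tame level `m` -/

section LFunction

variable {N : ℕ} (f : CuspForm (Gamma0 N) 2) {p : ℕ} [Fact p.Prime] (m : ℕ) [NeZero m]

/-- The `n`-th **Riemann sum** for the `k`-th coefficient of `L⁻_p(f, α, χ, T)` at tame level `m`:
`∑_ζ ∑_{s mod pⁿ} ∑_{b mod m} χ(b) · μ⁻_{f,α,m}((ζ γˢ + p^{n+e₀}ℤ_p) × {b}) · (s choose k)` — the formula of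
`padicLRiemannSumTame` with `μ⁻_{f,α,m}` for `μ_{f,α,m}` (`ζ` over the torsion of `ℤ_pˣ`; the binder is not called `η`, the scoped
Dedekind-eta notation); `χ` has values in `ℚ_p`.
[cite: MazurTateTeitelbaum1986Invent, §I.13 (pp. 18–19)] -/
def padicLRiemannSumTameMinus (α : ℚ_[p]) (χ : DirichletCharacter ℚ_[p] m) (k n : ℕ) : ℚ_[p] :=
  ∑ᶠ ζ : rootsOfUnity (torsionOrder p) ℤ_[p], ∑ s : ZMod (p ^ n), ∑ b : ZMod m,
    χ b *
      msdMeasureTameMinus f m α (n + cyclotomicExponent p)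
          (PadicInt.toZModPow (n + cyclotomicExponent p) ((ζ : ℤ_[p]ˣ) : ℤ_[p]) *
            (cyclotomicGenerator p : ZMod (p ^ (n + cyclotomicExponent p))) ^ s.val) b *
      (s.val.choose k : ℚ_[p])

/-- The `k`-th **coefficient** of `L⁻_p(f, α, χ, T)` at tame level `m`: `lim_n padicLRiemannSumTameMinus f m α χ k n` (junk
value of `limUnder` off the convergent case). [cite: MazurTateTeitelbaum1986Invent, §I.11–I.13 (pp. 13–19)] -/
def padicLCoeffTameMinus (α : ℚ_[p]) (χ : DirichletCharacter ℚ_[p] m) (k : ℕ) : ℚ_[p] :=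
  limUnder atTop (padicLRiemannSumTameMinus f m α χ k)

/-- The **`χ`-twisted `p`-adic `L`-function of the MINUS measure at tame level `m`**:
`L⁻_p(f, α, χ, T) = ∫_{ℤ_pˣ × ℤ/m} χ(x_m) (1 + T)^{ℓ(x_p)} dμ⁻_{f,α,m} ∈ ℚ_p⟦T⟧` (Mazur–Tate–Teitelbaum §I.13 with a tame
character, minus part). For `χ = ψ` quadratic ODD of conductor `m` it is the function whose Birch transform is
`L_p(f ⊗ ψ, ψ(p)α, T)`. [cite: MazurTateTeitelbaum1986Invent, §I.13 (pp. 18–19)] [cite: Matsuno2000, §2 (p. 83)] -/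
def padicLFunctionTameMinus (α : ℚ_[p]) (χ : DirichletCharacter ℚ_[p] m) : PowerSeries ℚ_[p] :=
  PowerSeries.mk (padicLCoeffTameMinus f m α χ)

/-- The `k`-th coefficient of `L⁻_p(f, α, χ, T)` is `padicLCoeffTameMinus f m α χ k` (unfolding).
[cite: MazurTateTeitelbaum1986Invent, §I.13 (pp. 18–19)] -/
theorem coeff_padicLFunctionTameMinus (α : ℚ_[p]) (χ : DirichletCharacter ℚ_[p] m) (k : ℕ) :
    PowerSeries.coeff k (padicLFunctionTameMinus f m α χ) = padicLCoeffTameMinus f m α χ k :=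
  PowerSeries.coeff_mk _ _

end LFunction

/-! #### Anchor at `m = 1`, `χ = 1`: the `ω⁰`-branch Riemann sums of the minus measure -/

section Anchor

variable {N : ℕ} (f : CuspForm (Gamma0 N) 2) {p : ℕ} [Fact p.Prime]

/-- **Anchor**: at `m = 1`, `χ = 1` the minus tame Riemann sums ARE the `ω⁰`-branch Riemann sums of the minus measure
(`padicLMinusBranchRiemannSum f α 0`, weight `ζ⁰ = 1`; `msdMeasureTameMinus_one`).
[cite: MazurTateTeitelbaum1986Invent, §I.13 (pp. 18–19)] -/
theorem padicLRiemannSumTameMinus_one (α : ℚ_[p]) (k n : ℕ) :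
    padicLRiemannSumTameMinus f 1 α (1 : DirichletCharacter ℚ_[p] 1) k n = padicLMinusBranchRiemannSum f α 0 k n := by
  unfold padicLRiemannSumTameMinus padicLMinusBranchRiemannSum
  refine finsum_congr fun ζ => Finset.sum_congr rfl fun s _ => ?_
  rw [Fintype.sum_subsingleton _ (1 : ZMod 1), map_one, one_mul, msdMeasureTameMinus_one, pow_zero, one_mul]

/-- **Anchor**: `padicLCoeffTameMinus f 1 α 1 k = padicLMinusBranchCoeff f α 0 k`.
[cite: MazurTateTeitelbaum1986Invent, §I.13 (pp. 18–19)] -/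
theorem padicLCoeffTameMinus_one (α : ℚ_[p]) (k : ℕ) :
    padicLCoeffTameMinus f 1 α (1 : DirichletCharacter ℚ_[p] 1) k = padicLMinusBranchCoeff f α 0 k := by
  unfold padicLCoeffTameMinus padicLMinusBranchCoeff
  congr 1
  funext n
  exact padicLRiemannSumTameMinus_one f α k n

/-- **Anchor**: at `m = 1`, `χ = 1` the minus tame function IS the `ω⁰`-branch of the minus measure.
[cite: MazurTateTeitelbaum1986Invent, §I.13 (pp. 18–19)] -/
theorem padicLFunctionTameMinus_one (α : ℚ_[p]) :
    padicLFunctionTameMinus f 1 α (1 : DirichletCharacter ℚ_[p] 1) = padicLFunctionMinusBranch f α 0 := by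
  ext k
  rw [coeff_padicLFunctionTameMinus, coeff_padicLFunctionMinusBranch, padicLCoeffTameMinus_one]

end Anchor

end Literature.NumberTheory.EllipticCurves

end
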